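import Summits.Schanuel.Schanuel.Theorems.ZilberEacHyperellipticPoleFibres
import HarnessLib

/-!
# Arbitrary base branches, XXXVII: POLYNOMIAL fibres `y₀ = R(x₀)` and `y₀ = R(x₁)` over the
# curves `x₁^k = P(x₀)` — case ∧ dense for every non-constant `R`, every `(k, deg P)` but `deg P = k ≤ 2`

HONEST FRAMING.  Cell `pub-schanuel` (Zilber's Exponential-Algebraic Closedness, case ladder;
host summit Schanuel), seat 2, gen 29.  Files XXXIII–XXXVI decided the coordinate fibres `y₀ = x₁`,
`y₀ = x₀`.  A non-constant polynomial `R` in ONE of the coordinates has a pole along every sheet at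
infinity of `C : x₁^k = P(x₀)` (`R(x₀) = U(s)s^{-k·deg R}`, `R(x₁) = U(s)s^{-M·deg R}` with
`U(0) = lc(R)·ζ^{deg R} ≠ 0`: the cell's `exists_polarForm_eval`), so the pole route applies
verbatim.  The three regimes are dispatched once (**`unprojectedDense_superelliptic_of_sheets`**):
`deg P > k` — flat sheet + logarithmic term (file XXXVI); `deg P ≤ k`, `k ≥ 3` — a non-real sheet
(file XXXIV); `(k, deg P) = (2, 1)` — the principal sheet off the residue class (file XXXII).  Hence
**`unprojectedDensityQuestion_superelliptic_polyFibre_x₀`** / **`…_x₁`**: for `k ≥ 2`, `P` monic of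
degree `M ≥ 1` with a simple root, `(M ≠ k ∨ k ≥ 3)`, and EVERY non-constant `R ∈ ℂ[X]`,
`{x₁^k − P(x₀) = 0, y₀ = R(x₀)}` and `{x₁^k − P(x₀) = 0, y₀ = R(x₁)}` are in Mantova–Masser's case AND
dense.  Excluded: `M = k ≤ 2` (the conics `x₁² = x₀² + …`, asymptotic to lines of rational slope;
OPEN), and mixed fibres `R(x₀, x₁)` (the leading term along a sheet may cancel; not treated).
Decided instances of an OPEN question (Mantova–Masser, PLMS 2024 §1 p. 5); EC(3,2) OPEN; NOT
Schanuel's conjecture (neither used nor implied); EAC ⇏ SC.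
-/

noncomputable section

open Filter Topology Set Complex MvPolynomial
open Literature.NumberTheory.Transcendental Literature.ModelTheory.Zilber
open Literature.ModelTheory.ExponentialFields

set_option linter.dupNamespace false

namespace Summit.Schanuel.Schanuel.Theorems

section Superelliptic

variable (P : Polynomial ℂ)

/-! ## Part A. The dispatcher over the sheets of `x₁^k = P(x₀)` -/

/-- **Pole fibres over `x₁^k = P(x₀)`: the three regimes at once.**  `S` irreducible closed of
dimension `≤ 2`; `P` monic of degree `M ≥ 1`; `1 ≤ k`; `M ≠ k ∨ 3 ≤ k`; and for EVERY sheet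
`(ζ, Φ)` at infinity (`ζ^k = 1`, `Φ(0) = ζ`, `(Φ(s)s^{-M})^k = P(s^{-k})`) a pole/zero fibre value
`ψ(s)s^L` (`ψ(0) ≠ 0`, `L ≠ 0`) whose cylinder germ lies in `S`.  Then `S` is dense: `M > k` by the
flat principal sheet (file XXXVI), `M ≤ k`, `k ≥ 3` by a non-real sheet (file XXXIV), `(2, 1)` off
the residue class (file XXXII). [cite: MantovaMasser2023, §1 Further remarks, p. 5 (the question,
open in general)] (new) -/
theorem unprojectedDense_superelliptic_of_sheets {S : Set (Fin 2 ⊕ Fin 2 → ℂ)}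
    (hS : IsIrreducibleClosed ℂ S) (hdim : zariskiDim ℂ S ≤ (2 : ℕ)) {k : ℕ} (hk : 1 ≤ k)
    (hP : P.Monic) (hM : 1 ≤ P.natDegree) (hexc : P.natDegree ≠ k ∨ 3 ≤ k)
    (hfib : ∀ (ζ : ℂ) (Φ : ℂ → ℂ), ζ ^ k = 1 → AnalyticAt ℂ Φ 0 → Φ 0 = ζ →
      (∀ᶠ s in 𝓝[≠] (0 : ℂ), (Φ s * (s ^ P.natDegree)⁻¹) ^ k - P.eval (s ^ k)⁻¹ = 0) →
      ∃ (ψ : ℂ → ℂ) (L : ℤ), AnalyticAt ℂ ψ 0 ∧ ψ 0 ≠ 0 ∧ L ≠ 0 ∧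
        ∀ᶠ s in 𝓝[≠] (0 : ℂ), (Sum.elim ![(s ^ k)⁻¹, Φ s * (s ^ P.natDegree)⁻¹]
          ![ψ s * s ^ L, Complex.exp (Φ s * (s ^ P.natDegree)⁻¹)] : Fin 2 ⊕ Fin 2 → ℂ) ∈ S) :
    UnprojectedDense S := by
  set M := P.natDegree with hMdef
  by_cases hkM : k < M
  · -- flat principal sheet
    obtain ⟨Φ, hΦan, hΦ0, hflat, hsheet⟩ := superelliptic_sheet_facts_flat P hk hP hM (one_pow k)
    obtain ⟨ψ, L, hψ, hψ0, hL, hgerm⟩ := hfib 1 Φ (one_pow k) hΦan hΦ0 hsheet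
    exact unprojectedDense_branch_poleFibre_of_flat hS hdim hk hkM hL hψ hψ0 hΦan
      (by rw [hΦ0]; exact one_ne_zero) hflat hgerm
  · rcases hexc with hne | hk3
    · -- `M < k`; if `k ≥ 3` use a sheet, else `(k, M) = (2, 1)`: off the residue class
      by_cases hk3 : 3 ≤ k
      · obtain ⟨ζ, z, hζ, hz, hre⟩ := exists_sheet_direction hk3 M
        obtain ⟨Φ, hΦan, hΦ0, hsheet⟩ := superelliptic_sheet_facts P hk hP hζ
        obtain ⟨ψ, L, hψ, hψ0, -, hgerm⟩ := hfib ζ Φ hζ hΦan hΦ0 hsheet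
        exact unprojectedDense_branch_poleFibre_of_exists_direction hS hdim hk hM L hψ hψ0 hΦan
          ⟨z, hz, by rw [hΦ0]; exact hre⟩ hgerm
      · have hk2 : k = 2 := by omega
        have hM1 : M = 1 := by omega
        obtain ⟨Φ, hΦan, hΦ0, hsheet⟩ := superelliptic_sheet_facts P hk hP (one_pow k)
        obtain ⟨ψ, L, hψ, hψ0, -, hgerm⟩ := hfib 1 Φ (one_pow k) hΦan hΦ0 hsheet
        refine unprojectedDense_branch_poleFibre_of_not_residue hS hdim hk hM ?_ L hψ hψ0 hΦan hΦ0
          hgerm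
        rw [hM1, hk2]
        decide
    · obtain ⟨ζ, z, hζ, hz, hre⟩ := exists_sheet_direction hk3 M
      obtain ⟨Φ, hΦan, hΦ0, hsheet⟩ := superelliptic_sheet_facts P hk hP hζ
      obtain ⟨ψ, L, hψ, hψ0, -, hgerm⟩ := hfib ζ Φ hζ hΦan hΦ0 hsheet
      exact unprojectedDense_branch_poleFibre_of_exists_direction hS hdim hk hM L hψ hψ0 hΦan
        ⟨z, hz, by rw [hΦ0]; exact hre⟩ hgerm

/-! ## Part B. The fibre `y₀ = R(x₀)` -/

/-- **`y₀ = R(x₀)` over `x₁^k = P(x₀)`: dense** for every non-constant `R` (`k ≥ 1`, `P` monic of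
degree `M ≥ 1` with a simple root, `M ≠ k ∨ k ≥ 3`): along every sheet `R(x₀) = U(s)s^{-k·deg R}`,
`U(0) = lc R ≠ 0`. [cite: MantovaMasser2023, §1 Further remarks, p. 5 (the question, open in
general)] (new) -/
theorem unprojectedDense_superelliptic_polyFibre_x₀ (R : Polynomial ℂ) (hR : 1 ≤ R.natDegree)
    {k : ℕ} (hk : 1 ≤ k) (hP : P.Monic) (hM : 1 ≤ P.natDegree) {r : ℂ} (hr : P.IsRoot r)
    (hr1 : P.derivative.eval r ≠ 0) (hexc : P.natDegree ≠ k ∨ 3 ≤ k) :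
    UnprojectedDense {w : Fin 2 ⊕ Fin 2 → ℂ |
      MvPolynomial.eval ![w (Sum.inl 0), w (Sum.inl 1)]
          (X 1 ^ k - Polynomial.aeval (X 0 : MvPolynomial (Fin 2) ℂ) P) = 0 ∧
      w (Sum.inr 0) = MvPolynomial.eval ![w (Sum.inl 0), w (Sum.inl 1)]
        (Polynomial.aeval (X 0 : MvPolynomial (Fin 2) ℂ) R)} := by
  have hR0 : R ≠ 0 := by
    rintro rfl
    simp at hR
  have hS := isIrreducibleClosed_curveGraphFibre (Polynomial.aeval (X 0 : MvPolynomial (Fin 2) ℂ) R)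
    (irreducible_superellipticMv P hk hr hr1)
  have hdim := zariskiDim_curveGraphFibre (Polynomial.aeval (X 0 : MvPolynomial (Fin 2) ℂ) R)
    (irreducible_superellipticMv P hk hr hr1)
  refine unprojectedDense_superelliptic_of_sheets P hS (le_of_eq hdim) hk hP hM hexc ?_
  intro ζ Φ hζ hΦan hΦ0 hsheet
  obtain ⟨U, hUan, hU0, hUeval⟩ :=
    exists_polarForm_eval R (U := fun _ : ℂ => (1 : ℂ)) analyticAt_const hk
  rw [one_pow, mul_one] at hU0
  refine ⟨U, -((k * R.natDegree : ℕ) : ℤ), hUan, ?_, ?_, ?_⟩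
  · rw [hU0]
    exact Polynomial.leadingCoeff_ne_zero.2 hR0
  · have : k * R.natDegree ≠ 0 := Nat.mul_ne_zero (by omega) (by omega)
    simpa using this
  · filter_upwards [hsheet, self_mem_nhdsWithin] with s hs (hs0 : s ≠ 0)
    refine ⟨?_, ?_⟩
    · simp only [Sum.elim_inl, Matrix.cons_val_zero, Matrix.cons_val_one]
      rw [eval_superellipticMv]
      simpa only [Matrix.cons_val_zero, Matrix.cons_val_one] using hs
    · simp only [Sum.elim_inr, Sum.elim_inl, Matrix.cons_val_zero, eval_polynomial_aeval_X]
      have hU := hUeval s hs0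
      rw [one_mul, inv_pow] at hU
      rw [hU, zpow_neg, zpow_natCast, inv_pow]

/-- **Mantova–Masser's question for `{x₁^k − P(x₀) = 0, y₀ = R(x₀)}`: case ∧ dense** (`k ≥ 2`, `P`
monic of degree `M ≥ 1` with a simple root, `M ≠ k ∨ k ≥ 3`, `R` non-constant), in plain
coordinates. [cite: MantovaMasser2023, §1 Further remarks, p. 5 (the question, open in general)]
(new) -/
theorem unprojectedDensityQuestion_superelliptic_polyFibre_x₀ (R : Polynomial ℂ)
    (hR : 1 ≤ R.natDegree) {k : ℕ} (hk : 2 ≤ k) (hP : P.Monic) (hM : 1 ≤ P.natDegree) {r : ℂ}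
    (hr : P.IsRoot r) (hr1 : P.derivative.eval r ≠ 0) (hexc : P.natDegree ≠ k ∨ 3 ≤ k) :
    MMCaseDimPiOneFree {w : Fin 2 ⊕ Fin 2 → ℂ |
        w (Sum.inl 1) ^ k - P.eval (w (Sum.inl 0)) = 0 ∧ w (Sum.inr 0) = R.eval (w (Sum.inl 0))} ∧
      UnprojectedDense {w : Fin 2 ⊕ Fin 2 → ℂ |
        w (Sum.inl 1) ^ k - P.eval (w (Sum.inl 0)) = 0 ∧ w (Sum.inr 0) = R.eval (w (Sum.inl 0))} := by
  classical
  have hP0 : P ≠ 0 := by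
    rintro rfl
    simp at hr1
  have hR0 : R ≠ 0 := by
    rintro rfl
    simp at hR
  have hcase : MMCaseDimPiOneFree {w : Fin 2 ⊕ Fin 2 → ℂ |
      MvPolynomial.eval ![w (Sum.inl 0), w (Sum.inl 1)]
          (X 1 ^ k - Polynomial.aeval (X 0 : MvPolynomial (Fin 2) ℂ) P) = 0 ∧
      w (Sum.inr 0) = MvPolynomial.eval ![w (Sum.inl 0), w (Sum.inl 1)]
        (Polynomial.aeval (X 0 : MvPolynomial (Fin 2) ℂ) R)} := by
    refine mmCase_curveGraphFibre (irreducible_superellipticMv P (by omega) hr hr1) ?_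
      (superelliptic_not_on_line P hk hP0)
    -- a point of the curve with `R(x₀) ≠ 0`: avoid the finitely many roots of `R`
    obtain ⟨x₀, hx₀⟩ := R.roots.toFinset.exists_notMem
    rw [Multiset.mem_toFinset, Polynomial.mem_roots hR0] at hx₀
    obtain ⟨y, hy⟩ := IsAlgClosed.exists_pow_nat_eq (P.eval x₀) (by omega : 0 < k)
    refine ⟨![x₀, y], by rw [eval_superellipticMv]; simp [hy], ?_⟩
    rw [eval_polynomial_aeval_X]
    simpa using hx₀
  have e : {w : Fin 2 ⊕ Fin 2 → ℂ |
        MvPolynomial.eval ![w (Sum.inl 0), w (Sum.inl 1)]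
            (X 1 ^ k - Polynomial.aeval (X 0 : MvPolynomial (Fin 2) ℂ) P) = 0 ∧
        w (Sum.inr 0) = MvPolynomial.eval ![w (Sum.inl 0), w (Sum.inl 1)]
          (Polynomial.aeval (X 0 : MvPolynomial (Fin 2) ℂ) R)} =
      {w : Fin 2 ⊕ Fin 2 → ℂ |
        w (Sum.inl 1) ^ k - P.eval (w (Sum.inl 0)) = 0 ∧ w (Sum.inr 0) = R.eval (w (Sum.inl 0))} := by
    ext w
    simp only [Set.mem_setOf_eq, eval_superellipticMv, eval_polynomial_aeval_X, Matrix.cons_val_zero,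
      Matrix.cons_val_one]
  have h : MMCaseDimPiOneFree _ ∧ UnprojectedDense _ :=
    ⟨hcase, unprojectedDense_superelliptic_polyFibre_x₀ P R hR (by omega) hP hM hr hr1 hexc⟩
  rw [e] at h
  exact h

/-! ## Part C. The fibre `y₀ = R(x₁)` -/

/-- **`y₀ = R(x₁)` over `x₁^k = P(x₀)`: dense** for every non-constant `R` (hypotheses as above):
along every sheet `R(x₁) = U(s)s^{-M·deg R}`, `U(0) = lc R·ζ^{deg R} ≠ 0`.
[cite: MantovaMasser2023, §1 Further remarks, p. 5 (the question, open in general)] (new) -/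
theorem unprojectedDense_superelliptic_polyFibre_x₁ (R : Polynomial ℂ) (hR : 1 ≤ R.natDegree)
    {k : ℕ} (hk : 1 ≤ k) (hP : P.Monic) (hM : 1 ≤ P.natDegree) {r : ℂ} (hr : P.IsRoot r)
    (hr1 : P.derivative.eval r ≠ 0) (hexc : P.natDegree ≠ k ∨ 3 ≤ k) :
    UnprojectedDense {w : Fin 2 ⊕ Fin 2 → ℂ |
      MvPolynomial.eval ![w (Sum.inl 0), w (Sum.inl 1)]
          (X 1 ^ k - Polynomial.aeval (X 0 : MvPolynomial (Fin 2) ℂ) P) = 0 ∧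
      w (Sum.inr 0) = MvPolynomial.eval ![w (Sum.inl 0), w (Sum.inl 1)]
        (Polynomial.aeval (X 1 : MvPolynomial (Fin 2) ℂ) R)} := by
  have hR0 : R ≠ 0 := by
    rintro rfl
    simp at hR
  have hS := isIrreducibleClosed_curveGraphFibre (Polynomial.aeval (X 1 : MvPolynomial (Fin 2) ℂ) R)
    (irreducible_superellipticMv P hk hr hr1)
  have hdim := zariskiDim_curveGraphFibre (Polynomial.aeval (X 1 : MvPolynomial (Fin 2) ℂ) R)
    (irreducible_superellipticMv P hk hr hr1)
  refine unprojectedDense_superelliptic_of_sheets P hS (le_of_eq hdim) hk hP hM hexc ?_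
  intro ζ Φ hζ hΦan hΦ0 hsheet
  have hζ0 : ζ ≠ 0 := by
    rintro rfl
    rw [zero_pow (by omega)] at hζ
    exact zero_ne_one hζ
  obtain ⟨U, hUan, hU0, hUeval⟩ := exists_polarForm_eval R hΦan hM
  refine ⟨U, -((P.natDegree * R.natDegree : ℕ) : ℤ), hUan, ?_, ?_, ?_⟩
  · rw [hU0, hΦ0]
    exact mul_ne_zero (Polynomial.leadingCoeff_ne_zero.2 hR0) (pow_ne_zero _ hζ0)
  · have : P.natDegree * R.natDegree ≠ 0 := Nat.mul_ne_zero (by omega) (by omega)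
    simpa using this
  · filter_upwards [hsheet, self_mem_nhdsWithin] with s hs (hs0 : s ≠ 0)
    refine ⟨?_, ?_⟩
    · simp only [Sum.elim_inl, Matrix.cons_val_zero, Matrix.cons_val_one]
      rw [eval_superellipticMv]
      simpa only [Matrix.cons_val_zero, Matrix.cons_val_one] using hs
    · simp only [Sum.elim_inr, Sum.elim_inl, Matrix.cons_val_zero, Matrix.cons_val_one,
        eval_polynomial_aeval_X]
      have hU := hUeval s hs0
      rw [inv_pow] at hU
      rw [hU, zpow_neg, zpow_natCast, inv_pow]

/-- **Mantova–Masser's question for `{x₁^k − P(x₀) = 0, y₀ = R(x₁)}`: case ∧ dense** (`k ≥ 2`, `P`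
monic of degree `M ≥ 1` with a simple root, `M ≠ k ∨ k ≥ 3`, `R` non-constant), in plain
coordinates. [cite: MantovaMasser2023, §1 Further remarks, p. 5 (the question, open in general)]
(new) -/
theorem unprojectedDensityQuestion_superelliptic_polyFibre_x₁ (R : Polynomial ℂ)
    (hR : 1 ≤ R.natDegree) {k : ℕ} (hk : 2 ≤ k) (hP : P.Monic) (hM : 1 ≤ P.natDegree) {r : ℂ}
    (hr : P.IsRoot r) (hr1 : P.derivative.eval r ≠ 0) (hexc : P.natDegree ≠ k ∨ 3 ≤ k) :
    MMCaseDimPiOneFree {w : Fin 2 ⊕ Fin 2 → ℂ |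
        w (Sum.inl 1) ^ k - P.eval (w (Sum.inl 0)) = 0 ∧ w (Sum.inr 0) = R.eval (w (Sum.inl 1))} ∧
      UnprojectedDense {w : Fin 2 ⊕ Fin 2 → ℂ |
        w (Sum.inl 1) ^ k - P.eval (w (Sum.inl 0)) = 0 ∧ w (Sum.inr 0) = R.eval (w (Sum.inl 1))} := by
  classical
  have hP0 : P ≠ 0 := by
    rintro rfl
    simp at hr1
  have hR0 : R ≠ 0 := by
    rintro rfl
    simp at hR
  have hcase : MMCaseDimPiOneFree {w : Fin 2 ⊕ Fin 2 → ℂ |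
      MvPolynomial.eval ![w (Sum.inl 0), w (Sum.inl 1)]
          (X 1 ^ k - Polynomial.aeval (X 0 : MvPolynomial (Fin 2) ℂ) P) = 0 ∧
      w (Sum.inr 0) = MvPolynomial.eval ![w (Sum.inl 0), w (Sum.inl 1)]
        (Polynomial.aeval (X 1 : MvPolynomial (Fin 2) ℂ) R)} := by
    refine mmCase_curveGraphFibre (irreducible_superellipticMv P (by omega) hr hr1) ?_
      (superelliptic_not_on_line P hk hP0)
    -- a point of the curve with `R(x₁) ≠ 0`: choose `x₁` off the roots of `R`, then `x₀` with
    -- `P(x₀) = x₁^k` (`P` non-constant)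
    obtain ⟨x₁, hx₁⟩ := R.roots.toFinset.exists_notMem
    rw [Multiset.mem_toFinset, Polynomial.mem_roots hR0] at hx₁
    have hPc : 0 < (P - Polynomial.C (x₁ ^ k)).degree := by
      rw [Polynomial.degree_sub_C (by rw [Polynomial.degree_eq_natDegree hP0]; exact_mod_cast hM)]
      rw [Polynomial.degree_eq_natDegree hP0]
      exact_mod_cast hM
    obtain ⟨x₀, hx₀⟩ := Complex.exists_root hPc
    rw [Polynomial.IsRoot, Polynomial.eval_sub, Polynomial.eval_C, sub_eq_zero] at hx₀
    refine ⟨![x₀, x₁], by rw [eval_superellipticMv]; simp [hx₀], ?_⟩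
    rw [eval_polynomial_aeval_X]
    simpa using hx₁
  have e : {w : Fin 2 ⊕ Fin 2 → ℂ |
        MvPolynomial.eval ![w (Sum.inl 0), w (Sum.inl 1)]
            (X 1 ^ k - Polynomial.aeval (X 0 : MvPolynomial (Fin 2) ℂ) P) = 0 ∧
        w (Sum.inr 0) = MvPolynomial.eval ![w (Sum.inl 0), w (Sum.inl 1)]
          (Polynomial.aeval (X 1 : MvPolynomial (Fin 2) ℂ) R)} =
      {w : Fin 2 ⊕ Fin 2 → ℂ |
        w (Sum.inl 1) ^ k - P.eval (w (Sum.inl 0)) = 0 ∧ w (Sum.inr 0) = R.eval (w (Sum.inl 1))} := by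
    ext w
    simp only [Set.mem_setOf_eq, eval_superellipticMv, eval_polynomial_aeval_X, Matrix.cons_val_zero,
      Matrix.cons_val_one]
  have h : MMCaseDimPiOneFree _ ∧ UnprojectedDense _ :=
    ⟨hcase, unprojectedDense_superelliptic_polyFibre_x₁ P R hR (by omega) hP hM hr hr1 hexc⟩
  rw [e] at h
  exact h

/-- **Every hyperelliptic curve of degree `≥ 3`, every non-constant polynomial fibre in `x₀` or in
`x₁`**: `{x₁² − P(x₀) = 0, y₀ = R(x₀)}` and `{x₁² − P(x₀) = 0, y₀ = R(x₁)}` are in the case AND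
dense. [cite: MantovaMasser2023, §1 Further remarks, p. 5 (the question, open in general)] (new) -/
theorem unprojectedDensityQuestion_hyperelliptic_polyFibres (R : Polynomial ℂ) (hR : 1 ≤ R.natDegree)
    (hP : P.Monic) (h3 : 3 ≤ P.natDegree) {r : ℂ} (hr : P.IsRoot r) (hr1 : P.derivative.eval r ≠ 0) :
    (MMCaseDimPiOneFree {w : Fin 2 ⊕ Fin 2 → ℂ |
        w (Sum.inl 1) ^ 2 - P.eval (w (Sum.inl 0)) = 0 ∧ w (Sum.inr 0) = R.eval (w (Sum.inl 0))} ∧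
      UnprojectedDense {w : Fin 2 ⊕ Fin 2 → ℂ |
        w (Sum.inl 1) ^ 2 - P.eval (w (Sum.inl 0)) = 0 ∧ w (Sum.inr 0) = R.eval (w (Sum.inl 0))}) ∧
    (MMCaseDimPiOneFree {w : Fin 2 ⊕ Fin 2 → ℂ |
        w (Sum.inl 1) ^ 2 - P.eval (w (Sum.inl 0)) = 0 ∧ w (Sum.inr 0) = R.eval (w (Sum.inl 1))} ∧
      UnprojectedDense {w : Fin 2 ⊕ Fin 2 → ℂ |
        w (Sum.inl 1) ^ 2 - P.eval (w (Sum.inl 0)) = 0 ∧ w (Sum.inr 0) = R.eval (w (Sum.inl 1))}) :=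
  ⟨unprojectedDensityQuestion_superelliptic_polyFibre_x₀ P R hR (le_refl 2) hP (by omega) hr hr1
      (Or.inl (by omega)),
    unprojectedDensityQuestion_superelliptic_polyFibre_x₁ P R hR (le_refl 2) hP (by omega) hr hr1
      (Or.inl (by omega))⟩

end Superelliptic

end Summit.Schanuel.Schanuel.Theorems

end
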